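import Summits.Ventures.YMGap.Thresholds.OneLinkLevelTwoModulus
import Summits.Ventures.YMGap.Thresholds.OneLinkSDMeanTwo
import HarnessLib

/-!
# Venture YMGap — the one-link modulus beyond first order, part 18: the REFINED level-two modulus `K₂ʳ(N, R)` (second-order
# Schwinger–Dyson means) for every `SU(N)`, `N ≥ 3`, hypothesis-free

HONEST FRAMING: venture file of the cell `pub-ymgap` (QuantumFields programme), strong-coupling LATTICE bookkeeping for `SU(N)`
lattice Yang–Mills; nothing about the continuum or the mass gap in the Clay sense.  Same assembly as `OneLinkLevelTwoModulus`
(`levelTwo_algebra`) with the mean coefficient `2C` of the crude column replaced by the second-order Schwinger–Dyson coefficient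
`D_m(N,R) = C(1 + 1/(N·N(½−R)))/(1 − 2C²R²)` of `OneLinkSDMeanTwo` (cell note `HOME/p2/ONE-LINK-HIERARCHY.md` §4 (4.2), column
«m₁ second order»; `μ₂`, `ω` still crude).

WHAT.  With `E = N²/(2(N²−4))`, `C = N²/(N²−1)`, `D_m` as above:
  `K₂ʳ(N,R) = C·( 1 + E R + 2D_m(E+¼)R² + (2(E+¼)/N)·R/√(½−R) + [ (5E+¼)R² + D_m(10E+½)R³ + ((10E+½)/N)·R²/√(½−R) ] / (½ − R) )`.
* `cov_linear_le_levelTwoR_explicit`, `levelTwoRBody_mono`, and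
* `oneLinkKRModulus_levelTwoR (hN : 3 ≤ N) (hR : R < 1/2) : OneLinkKRModulus N R (K₂ʳ(N,R))`.
Numbers (`work/hier/k2_dm.py`): `K₂ʳ(10, 0.2) = 1.94` vs `K₂ = 2.13`, `K_ref = 2.50`; star rows `N ≥ 10 / 20 / 50`: `0.038 / 0.039 / 0.040`
(next file).

References: cell notes `HOME/p2/ONE-LINK-HIERARCHY.md` §4–§5; Shen–Zhu–Zhu CMP 400 (2023) §4.1.
-/

noncomputable section

open scoped Matrix ComplexConjugate BigOperators ContDiff Matrix.Norms.Frobenius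
open Matrix Complex Finset MeasureTheory ProbabilityTheory
open Literature.MathematicalPhysics.QuantumFieldTheory
open Literature.MathematicalPhysics.QuantumFieldTheory.SUNBakryEmery
open Literature.MathematicalPhysics.QuantumFieldTheory.Balaban1983to89.StrongCouplingDobrushinWindow
open Literature.MathematicalPhysics.QuantumFieldTheory.Balaban1983to89.StrongCouplingKernelWindow

namespace Summit.Ventures.YMGap.OneLinkEigen

variable {N : ℕ}

/-- `C = N²/(N²−1) ≤ 9/8` for `N ≥ 3`, hence `1 − 2C²r² > 0` for `r < 1/2`. [folklore] -/
theorem levelTwoR_den_pos (hN : 3 ≤ N) {r : ℝ} (hr0 : 0 ≤ r) (hr : r < 1 / 2) :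
    0 < 1 - 2 * ((N : ℝ) ^ 2 / ((N : ℝ) ^ 2 - 1)) ^ 2 * r ^ 2 := by
  have h3 : (3 : ℝ) ≤ N := by exact_mod_cast hN
  have hN1 : (0 : ℝ) < (N : ℝ) ^ 2 - 1 := by nlinarith
  have hC : (N : ℝ) ^ 2 / ((N : ℝ) ^ 2 - 1) ≤ 9 / 8 := by
    rw [div_le_iff₀ hN1]; nlinarith
  have hC0 : 0 ≤ (N : ℝ) ^ 2 / ((N : ℝ) ^ 2 - 1) := div_nonneg (by positivity) hN1.le
  have h1 : ((N : ℝ) ^ 2 / ((N : ℝ) ^ 2 - 1)) ^ 2 ≤ (9 / 8) ^ 2 := pow_le_pow_left₀ hC0 hC 2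
  have h2 : r ^ 2 < (1 / 2) ^ 2 := pow_lt_pow_left₀ hr hr0 (by norm_num)
  nlinarith [sq_nonneg r, mul_nonneg (sub_nonneg.2 h1) (sq_nonneg r)]

/-- The refined mean coefficient `D_m(N, ·)` is nonnegative and increasing on `[0, 1/2)`. [folklore] -/
theorem levelTwoR_Dm_mono (hN : 3 ≤ N) {r R : ℝ} (hr : 0 ≤ r) (hrR : r ≤ R) (hR : R < 1 / 2) :
    0 ≤ (((N : ℝ) ^ 2 / ((N : ℝ) ^ 2 - 1)) * (1 + 1 / ((N : ℝ) * ((N : ℝ) * (1 / 2 - r)))) / (1 - 2 * ((N : ℝ) ^ 2 / ((N : ℝ) ^ 2 - 1)) ^ 2 * r ^ 2)) ∧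
      (((N : ℝ) ^ 2 / ((N : ℝ) ^ 2 - 1)) * (1 + 1 / ((N : ℝ) * ((N : ℝ) * (1 / 2 - r)))) / (1 - 2 * ((N : ℝ) ^ 2 / ((N : ℝ) ^ 2 - 1)) ^ 2 * r ^ 2)) ≤ (((N : ℝ) ^ 2 / ((N : ℝ) ^ 2 - 1)) * (1 + 1 / ((N : ℝ) * ((N : ℝ) * (1 / 2 - R)))) / (1 - 2 * ((N : ℝ) ^ 2 / ((N : ℝ) ^ 2 - 1)) ^ 2 * R ^ 2)) := by
  have h3 : (3 : ℝ) ≤ N := by exact_mod_cast hN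
  have hN1 : (0 : ℝ) < (N : ℝ) ^ 2 - 1 := by nlinarith
  have hNpos : (0 : ℝ) < N := by linarith
  set C : ℝ := (N : ℝ) ^ 2 / ((N : ℝ) ^ 2 - 1) with hCdef
  have hC0 : 0 ≤ C := div_nonneg (by positivity) hN1.le
  have hR0 : 0 ≤ R := hr.trans hrR
  have hdr := levelTwoR_den_pos hN hr (lt_of_le_of_lt hrR hR)
  have hdR := levelTwoR_den_pos hN hR0 hR
  rw [← hCdef] at hdr hdR
  have hTr : 0 < 1 / 2 - r := by linarith
  have hTR : 0 < 1 / 2 - R := by linarith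
  have hnum : C * (1 + 1 / ((N : ℝ) * ((N : ℝ) * (1 / 2 - r)))) ≤ C * (1 + 1 / ((N : ℝ) * ((N : ℝ) * (1 / 2 - R)))) := by
    refine mul_le_mul_of_nonneg_left ?_ hC0
    have : 1 / ((N : ℝ) * ((N : ℝ) * (1 / 2 - r))) ≤ 1 / ((N : ℝ) * ((N : ℝ) * (1 / 2 - R))) :=
      one_div_le_one_div_of_le (by positivity) (by nlinarith [mul_pos hNpos hNpos])
    linarith
  have hnum0 : 0 ≤ C * (1 + 1 / ((N : ℝ) * ((N : ℝ) * (1 / 2 - r)))) := by positivity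
  have hnumR0 : 0 ≤ C * (1 + 1 / ((N : ℝ) * ((N : ℝ) * (1 / 2 - R)))) := by positivity
  have hden : 1 - 2 * C ^ 2 * R ^ 2 ≤ 1 - 2 * C ^ 2 * r ^ 2 := by
    nlinarith [pow_le_pow_left₀ hr hrR 2, sq_nonneg C]
  exact ⟨div_nonneg hnum0 hdr.le, div_le_div₀ hnumR0 hnum hdR hden⟩

/-! ### The explicit refined covariance bound -/

/-- **THE REFINED SECOND-ORDER COVARIANCE BOUND, explicit** (`N ≥ 3`, `‖B‖_op < 1/2`, `φ` bounded measurable `L`-Lipschitz):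
`|∫ φ · N Re tr(gΔ) dν_B − ∫ φ dν_B ∫ N Re tr(gΔ) dν_B| ≤ K₂ʳ(N, ‖B‖_op) · L · ‖Δ‖_F`. [folklore] -/
theorem cov_linear_le_levelTwoR_explicit (hN : 3 ≤ N) {B : Matrix (Fin N) (Fin N) ℂ} (hB : matrixOpNorm B < 1 / 2)
    (Δ : Matrix (Fin N) (Fin N) ℂ) (φ : SUN N → ℝ) {L : ℝ} (hφm : Measurable φ) (hφb : ∃ C, ∀ s, |φ s| ≤ C)
    (hL : 0 ≤ L) (hφL : ∀ a b, |φ a - φ b| ≤ L * suFrobDist a b) :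
    |∫ s, φ s * ((N : ℝ) * ((s : Matrix (Fin N) (Fin N) ℂ) * Δ).trace.re)
          ∂(haarProbability (SUN N)).tilted (fun g => (N : ℝ) * ((g : Matrix (Fin N) (Fin N) ℂ) * B).trace.re) -
        (∫ s, φ s ∂(haarProbability (SUN N)).tilted (fun g => (N : ℝ) * ((g : Matrix (Fin N) (Fin N) ℂ) * B).trace.re)) *
          ∫ s, (N : ℝ) * ((s : Matrix (Fin N) (Fin N) ℂ) * Δ).trace.re
            ∂(haarProbability (SUN N)).tilted (fun g => (N : ℝ) * ((g : Matrix (Fin N) (Fin N) ℂ) * B).trace.re)| ≤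
      (N : ℝ) ^ 2 / ((N : ℝ) ^ 2 - 1) *
        (1 + ((N : ℝ) ^ 2 / (2 * ((N : ℝ) ^ 2 - 4))) * matrixOpNorm B + 2 * (((N : ℝ) ^ 2 / ((N : ℝ) ^ 2 - 1)) * (1 + 1 / ((N : ℝ) * ((N : ℝ) * (1 / 2 - matrixOpNorm B)))) / (1 - 2 * ((N : ℝ) ^ 2 / ((N : ℝ) ^ 2 - 1)) ^ 2 * matrixOpNorm B ^ 2)) * (((N : ℝ) ^ 2 / (2 * ((N : ℝ) ^ 2 - 4))) + 1 / 4) * matrixOpNorm B ^ 2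
          + 2 * ((((N : ℝ) ^ 2 / (2 * ((N : ℝ) ^ 2 - 4))) + 1 / 4) / N) * (matrixOpNorm B / Real.sqrt (1 / 2 - matrixOpNorm B))
          + ((5 * ((N : ℝ) ^ 2 / (2 * ((N : ℝ) ^ 2 - 4))) + 1 / 4) * matrixOpNorm B ^ 2 + (((N : ℝ) ^ 2 / ((N : ℝ) ^ 2 - 1)) * (1 + 1 / ((N : ℝ) * ((N : ℝ) * (1 / 2 - matrixOpNorm B)))) / (1 - 2 * ((N : ℝ) ^ 2 / ((N : ℝ) ^ 2 - 1)) ^ 2 * matrixOpNorm B ^ 2)) * (10 * ((N : ℝ) ^ 2 / (2 * ((N : ℝ) ^ 2 - 4))) + 1 / 2) * matrixOpNorm B ^ 3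
              + ((10 * ((N : ℝ) ^ 2 / (2 * ((N : ℝ) ^ 2 - 4))) + 1 / 2) / N) * (matrixOpNorm B ^ 2 / Real.sqrt (1 / 2 - matrixOpNorm B))) / (1 / 2 - matrixOpNorm B)) * L * frobNorm Δ := by
  have h2 : 2 ≤ N := by omega
  have h3 : (3 : ℝ) ≤ N := by exact_mod_cast hN
  have hNpos : (0 : ℝ) < N := by linarith
  have hN1 : (0 : ℝ) < (N : ℝ) ^ 2 - 1 := by nlinarith
  set r : ℝ := matrixOpNorm B with hr
  have hr0 : 0 ≤ r := matrixOpNorm_nonneg B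
  have hDC : (N : ℝ) / ((N : ℝ) - 1 / N) = (N : ℝ) ^ 2 / ((N : ℝ) ^ 2 - 1) := by field_simp
  have hden : 0 < 1 - 2 * ((N : ℝ) / ((N : ℝ) - 1 / N)) ^ 2 * r ^ 2 := by rw [hDC]; exact levelTwoR_den_pos hN hr0 hB
  have hT : 0 < 1 / 2 - r := by linarith
  have hD0 : 0 ≤ (N : ℝ) / ((N : ℝ) - 1 / N) := by rw [hDC]; exact div_nonneg (by positivity) hN1.le
  have hΦ0 : 0 ≤ (N : ℝ) / ((N : ℝ) - 1 / N) * (1 + 1 / ((N : ℝ) * ((N : ℝ) * (1 / 2 - r)))) := by positivity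
  have hDm : 0 ≤ (N : ℝ) / ((N : ℝ) - 1 / N) * (1 + 1 / ((N : ℝ) * ((N : ℝ) * (1 / 2 - r))))
      / (1 - 2 * ((N : ℝ) / ((N : ℝ) - 1 / N)) ^ 2 * r ^ 2) := div_nonneg hΦ0 hden.le
  have hnB : frobNorm B ≤ Real.sqrt N * r := frobNorm_le_sqrt_mul_matrixOpNorm B
  -- the refined second moments, in the shape `D_m · (√N r ‖M‖_F) + ‖M‖_F/√ρ`
  have conv : ∀ M : Matrix (Fin N) (Fin N) ℂ,
      (N : ℝ) / ((N : ℝ) - 1 / N) * frobNorm B * frobNorm M * (1 + 1 / ((N : ℝ) * ((N : ℝ) * (1 / 2 - r))))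
          / (1 - 2 * ((N : ℝ) / ((N : ℝ) - 1 / N)) ^ 2 * r ^ 2) ≤
        (N : ℝ) / ((N : ℝ) - 1 / N) * (1 + 1 / ((N : ℝ) * ((N : ℝ) * (1 / 2 - r))))
          / (1 - 2 * ((N : ℝ) / ((N : ℝ) - 1 / N)) ^ 2 * r ^ 2) * (Real.sqrt N * r * frobNorm M) := by
    intro M
    have hM0 := frobNorm_nonneg M
    have e : (N : ℝ) / ((N : ℝ) - 1 / N) * frobNorm B * frobNorm M * (1 + 1 / ((N : ℝ) * ((N : ℝ) * (1 / 2 - r))))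
          / (1 - 2 * ((N : ℝ) / ((N : ℝ) - 1 / N)) ^ 2 * r ^ 2) =
        (N : ℝ) / ((N : ℝ) - 1 / N) * (1 + 1 / ((N : ℝ) * ((N : ℝ) * (1 / 2 - r))))
          / (1 - 2 * ((N : ℝ) / ((N : ℝ) - 1 / N)) ^ 2 * r ^ 2) * (frobNorm B * frobNorm M) := by ring
    rw [e]
    refine mul_le_mul_of_nonneg_left ?_ hDm
    calc frobNorm B * frobNorm M ≤ (Real.sqrt N * r) * frobNorm M := mul_le_mul_of_nonneg_right hnB hM0
      _ = Real.sqrt N * r * frobNorm M := by ring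
  have hZ1 := (sqrt_integral_normSq_trace_le_two h2 hB B).trans (add_le_add (conv B) le_rfl)
  have hZ2 := (sqrt_integral_normSq_trace_le_two h2 hB Δ).trans (add_le_add (conv Δ) le_rfl)
  refine (levelTwo_algebra hN rfl rfl hDm rfl rfl rfl rfl hr0 hB (frobNorm_nonneg B) (frobNorm_nonneg Δ) hL
    hnB hZ1 hZ2 (sqrt_integral_Gam_upsi_le hN B Δ) (sqrt_integral_Gam_c3_le hN B Δ)
    (cov_linear_le_levelTwo hN hB Δ φ hφm hφb hL hφL)).trans (le_of_eq ?_)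
  rw [hDC]

/-! ### Monotonicity and the refined modulus -/

/-- `K₂ʳ(N, ·)` is increasing on `[0, 1/2)`. [folklore] -/
theorem levelTwoRBody_mono (hN : 3 ≤ N) {r R : ℝ} (hr : 0 ≤ r) (hrR : r ≤ R) (hR : R < 1 / 2) :
    (N : ℝ) ^ 2 / ((N : ℝ) ^ 2 - 1) *
        (1 + ((N : ℝ) ^ 2 / (2 * ((N : ℝ) ^ 2 - 4))) * r + 2 * (((N : ℝ) ^ 2 / ((N : ℝ) ^ 2 - 1)) * (1 + 1 / ((N : ℝ) * ((N : ℝ) * (1 / 2 - r)))) / (1 - 2 * ((N : ℝ) ^ 2 / ((N : ℝ) ^ 2 - 1)) ^ 2 * r ^ 2)) * (((N : ℝ) ^ 2 / (2 * ((N : ℝ) ^ 2 - 4))) + 1 / 4) * r ^ 2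
          + 2 * ((((N : ℝ) ^ 2 / (2 * ((N : ℝ) ^ 2 - 4))) + 1 / 4) / N) * (r / Real.sqrt (1 / 2 - r))
          + ((5 * ((N : ℝ) ^ 2 / (2 * ((N : ℝ) ^ 2 - 4))) + 1 / 4) * r ^ 2 + (((N : ℝ) ^ 2 / ((N : ℝ) ^ 2 - 1)) * (1 + 1 / ((N : ℝ) * ((N : ℝ) * (1 / 2 - r)))) / (1 - 2 * ((N : ℝ) ^ 2 / ((N : ℝ) ^ 2 - 1)) ^ 2 * r ^ 2)) * (10 * ((N : ℝ) ^ 2 / (2 * ((N : ℝ) ^ 2 - 4))) + 1 / 2) * r ^ 3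
              + ((10 * ((N : ℝ) ^ 2 / (2 * ((N : ℝ) ^ 2 - 4))) + 1 / 2) / N) * (r ^ 2 / Real.sqrt (1 / 2 - r))) / (1 / 2 - r)) ≤
      (N : ℝ) ^ 2 / ((N : ℝ) ^ 2 - 1) *
        (1 + ((N : ℝ) ^ 2 / (2 * ((N : ℝ) ^ 2 - 4))) * R + 2 * (((N : ℝ) ^ 2 / ((N : ℝ) ^ 2 - 1)) * (1 + 1 / ((N : ℝ) * ((N : ℝ) * (1 / 2 - R)))) / (1 - 2 * ((N : ℝ) ^ 2 / ((N : ℝ) ^ 2 - 1)) ^ 2 * R ^ 2)) * (((N : ℝ) ^ 2 / (2 * ((N : ℝ) ^ 2 - 4))) + 1 / 4) * R ^ 2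
          + 2 * ((((N : ℝ) ^ 2 / (2 * ((N : ℝ) ^ 2 - 4))) + 1 / 4) / N) * (R / Real.sqrt (1 / 2 - R))
          + ((5 * ((N : ℝ) ^ 2 / (2 * ((N : ℝ) ^ 2 - 4))) + 1 / 4) * R ^ 2 + (((N : ℝ) ^ 2 / ((N : ℝ) ^ 2 - 1)) * (1 + 1 / ((N : ℝ) * ((N : ℝ) * (1 / 2 - R)))) / (1 - 2 * ((N : ℝ) ^ 2 / ((N : ℝ) ^ 2 - 1)) ^ 2 * R ^ 2)) * (10 * ((N : ℝ) ^ 2 / (2 * ((N : ℝ) ^ 2 - 4))) + 1 / 2) * R ^ 3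
              + ((10 * ((N : ℝ) ^ 2 / (2 * ((N : ℝ) ^ 2 - 4))) + 1 / 2) / N) * (R ^ 2 / Real.sqrt (1 / 2 - R))) / (1 / 2 - R)) := by
  have h3 : (3 : ℝ) ≤ N := by exact_mod_cast hN
  have hN4 : (0 : ℝ) < (N : ℝ) ^ 2 - 4 := by nlinarith only [h3]
  have hN1 : (0 : ℝ) < (N : ℝ) ^ 2 - 1 := by nlinarith only [h3]
  have hNpos : (0 : ℝ) < N := by linarith only [h3]
  obtain ⟨hDm0, hDmle⟩ := levelTwoR_Dm_mono hN hr hrR hR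
  set C : ℝ := (N : ℝ) ^ 2 / ((N : ℝ) ^ 2 - 1) with hCdef
  set E : ℝ := (N : ℝ) ^ 2 / (2 * ((N : ℝ) ^ 2 - 4)) with hE
  set Dr : ℝ := C * (1 + 1 / ((N : ℝ) * ((N : ℝ) * (1 / 2 - r)))) / (1 - 2 * C ^ 2 * r ^ 2) with hDr
  set DR : ℝ := C * (1 + 1 / ((N : ℝ) * ((N : ℝ) * (1 / 2 - R)))) / (1 - 2 * C ^ 2 * R ^ 2) with hDR
  have hDR0 : 0 ≤ DR := hDm0.trans hDmle
  have hC0 : 0 ≤ C := div_nonneg (by positivity) hN1.le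
  have hE0 : 0 ≤ E := by positivity
  have hR0 : 0 ≤ R := hr.trans hrR
  have h1 : 0 < 1 / 2 - R := by linarith only [hR]
  have h2 : 0 < 1 / 2 - r := by linarith only [hrR, hR]
  have hsR : 0 < Real.sqrt (1 / 2 - R) := Real.sqrt_pos.2 h1
  have hsle : Real.sqrt (1 / 2 - R) ≤ Real.sqrt (1 / 2 - r) := Real.sqrt_le_sqrt (by linarith only [hrR])
  have p2 : r ^ 2 ≤ R ^ 2 := pow_le_pow_left₀ hr hrR 2
  have p3 : r ^ 3 ≤ R ^ 3 := pow_le_pow_left₀ hr hrR 3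
  have q1 : r / Real.sqrt (1 / 2 - r) ≤ R / Real.sqrt (1 / 2 - R) := div_le_div₀ hR0 hrR hsR hsle
  have q2 : r ^ 2 / Real.sqrt (1 / 2 - r) ≤ R ^ 2 / Real.sqrt (1 / 2 - R) := div_le_div₀ (by positivity) p2 hsR hsle
  have d2 : Dr * r ^ 2 ≤ DR * R ^ 2 := mul_le_mul hDmle p2 (by positivity) hDR0
  have d3 : Dr * r ^ 3 ≤ DR * R ^ 3 := mul_le_mul hDmle p3 (by positivity) hDR0
  have hnum : (5 * E + 1 / 4) * r ^ 2 + Dr * (10 * E + 1 / 2) * r ^ 3 + ((10 * E + 1 / 2) / N) * (r ^ 2 / Real.sqrt (1 / 2 - r)) ≤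
      (5 * E + 1 / 4) * R ^ 2 + DR * (10 * E + 1 / 2) * R ^ 3 + ((10 * E + 1 / 2) / N) * (R ^ 2 / Real.sqrt (1 / 2 - R)) := by
    have a1 := mul_le_mul_of_nonneg_left p2 (by positivity : (0 : ℝ) ≤ 5 * E + 1 / 4)
    have a2 := mul_le_mul_of_nonneg_left d3 (by positivity : (0 : ℝ) ≤ 10 * E + 1 / 2)
    have a3 := mul_le_mul_of_nonneg_left q2 (by positivity : (0 : ℝ) ≤ (10 * E + 1 / 2) / N)
    have e1 : Dr * (10 * E + 1 / 2) * r ^ 3 = (10 * E + 1 / 2) * (Dr * r ^ 3) := by ring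
    have e2 : DR * (10 * E + 1 / 2) * R ^ 3 = (10 * E + 1 / 2) * (DR * R ^ 3) := by ring
    rw [e1, e2]
    linarith only [a1, a2, a3]
  have hnum0 : 0 ≤ (5 * E + 1 / 4) * R ^ 2 + DR * (10 * E + 1 / 2) * R ^ 3
      + ((10 * E + 1 / 2) / N) * (R ^ 2 / Real.sqrt (1 / 2 - R)) := by positivity
  have hfrac := div_le_div₀ hnum0 hnum h1 (by linarith only [hrR] : 1 / 2 - R ≤ 1 / 2 - r)
  have b1 := mul_le_mul_of_nonneg_left hrR hE0
  have b2 := mul_le_mul_of_nonneg_left d2 (by positivity : (0 : ℝ) ≤ 2 * (E + 1 / 4))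
  have b3 := mul_le_mul_of_nonneg_left q1 (by positivity : (0 : ℝ) ≤ 2 * ((E + 1 / 4) / N))
  have e3 : 2 * Dr * (E + 1 / 4) * r ^ 2 = 2 * (E + 1 / 4) * (Dr * r ^ 2) := by ring
  have e4 : 2 * DR * (E + 1 / 4) * R ^ 2 = 2 * (E + 1 / 4) * (DR * R ^ 2) := by ring
  refine mul_le_mul_of_nonneg_left ?_ hC0
  rw [e3, e4]
  linarith only [b1, b2, b3, hfrac]

/-- **THE REFINED LEVEL-TWO ONE-LINK KANTOROVICH–RUBINSTEIN MODULUS, EVERY `SU(N)`, `N ≥ 3`, HYPOTHESIS-FREE**: for `R < 1/2`,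
`OneLinkKRModulus N R (K₂ʳ(N,R))` (second-order Schwinger–Dyson means; tilt interpolation as in `oneLinkKRModulus_levelTwo`).
[cite: arXiv220412737, Lemma 4.1 and Rem. 1.3] -/
theorem oneLinkKRModulus_levelTwoR (hN : 3 ≤ N) {R : ℝ} (hR : R < 1 / 2) :
    OneLinkKRModulus N R
      ((N : ℝ) ^ 2 / ((N : ℝ) ^ 2 - 1) *
        (1 + ((N : ℝ) ^ 2 / (2 * ((N : ℝ) ^ 2 - 4))) * R + 2 * (((N : ℝ) ^ 2 / ((N : ℝ) ^ 2 - 1)) * (1 + 1 / ((N : ℝ) * ((N : ℝ) * (1 / 2 - R)))) / (1 - 2 * ((N : ℝ) ^ 2 / ((N : ℝ) ^ 2 - 1)) ^ 2 * R ^ 2)) * (((N : ℝ) ^ 2 / (2 * ((N : ℝ) ^ 2 - 4))) + 1 / 4) * R ^ 2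
          + 2 * ((((N : ℝ) ^ 2 / (2 * ((N : ℝ) ^ 2 - 4))) + 1 / 4) / N) * (R / Real.sqrt (1 / 2 - R))
          + ((5 * ((N : ℝ) ^ 2 / (2 * ((N : ℝ) ^ 2 - 4))) + 1 / 4) * R ^ 2 + (((N : ℝ) ^ 2 / ((N : ℝ) ^ 2 - 1)) * (1 + 1 / ((N : ℝ) * ((N : ℝ) * (1 / 2 - R)))) / (1 - 2 * ((N : ℝ) ^ 2 / ((N : ℝ) ^ 2 - 1)) ^ 2 * R ^ 2)) * (10 * ((N : ℝ) ^ 2 / (2 * ((N : ℝ) ^ 2 - 4))) + 1 / 2) * R ^ 3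
              + ((10 * ((N : ℝ) ^ 2 / (2 * ((N : ℝ) ^ 2 - 4))) + 1 / 2) / N) * (R ^ 2 / Real.sqrt (1 / 2 - R))) / (1 / 2 - R))) := by
  classical
  intro B B' hB hB' φ L hφm hφb hL hφL
  have hN0 : N ≠ 0 := by omega
  have hNpos : (0 : ℝ) < N := Nat.cast_pos.2 (Nat.pos_of_ne_zero hN0)
  set f : SUN N → ℝ := fun g => (N : ℝ) * ((g : Matrix (Fin N) (Fin N) ℂ) * B).trace.re with hf
  set w : SUN N → ℝ := fun g => (N : ℝ) * ((g : Matrix (Fin N) (Fin N) ℂ) * (B' - B)).trace.re with hw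
  have hfw : (fun g : SUN N => (N : ℝ) * ((g : Matrix (Fin N) (Fin N) ℂ) * B').trace.re) = fun g => f g + w g := by
    funext g
    simp only [hf, hw, Matrix.mul_sub, trace_sub, Complex.sub_re]
    ring
  rw [hfw, abs_sub_comm]
  have hfm : Measurable f := (continuous_const.mul (continuous_re_trace_su_mul B)).measurable
  have hwm : Measurable w := (continuous_const.mul (continuous_re_trace_su_mul (B' - B))).measurable
  have hfb : ∃ C, ∀ s, |f s| ≤ C := ⟨(N : ℝ) * (Real.sqrt N * frobNorm B), fun s => by
    simp only [hf]
    rw [abs_mul, abs_of_nonneg hNpos.le]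
    exact mul_le_mul_of_nonneg_left (abs_re_trace_su_mul_le s B) hNpos.le⟩
  have hwb : ∀ s, |w s| ≤ (N : ℝ) * (Real.sqrt N * frobNorm (B' - B)) := fun s => by
    simp only [hw]
    rw [abs_mul, abs_of_nonneg hNpos.le]
    exact mul_le_mul_of_nonneg_left (abs_re_trace_su_mul_le s _) hNpos.le
  have key := abs_integral_tilted_add_sub_le_of_cov (μ := haarProbability (SUN N))
    (A := ((N : ℝ) ^ 2 / ((N : ℝ) ^ 2 - 1) *
        (1 + ((N : ℝ) ^ 2 / (2 * ((N : ℝ) ^ 2 - 4))) * R + 2 * (((N : ℝ) ^ 2 / ((N : ℝ) ^ 2 - 1)) * (1 + 1 / ((N : ℝ) * ((N : ℝ) * (1 / 2 - R)))) / (1 - 2 * ((N : ℝ) ^ 2 / ((N : ℝ) ^ 2 - 1)) ^ 2 * R ^ 2)) * (((N : ℝ) ^ 2 / (2 * ((N : ℝ) ^ 2 - 4))) + 1 / 4) * R ^ 2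
          + 2 * ((((N : ℝ) ^ 2 / (2 * ((N : ℝ) ^ 2 - 4))) + 1 / 4) / N) * (R / Real.sqrt (1 / 2 - R))
          + ((5 * ((N : ℝ) ^ 2 / (2 * ((N : ℝ) ^ 2 - 4))) + 1 / 4) * R ^ 2 + (((N : ℝ) ^ 2 / ((N : ℝ) ^ 2 - 1)) * (1 + 1 / ((N : ℝ) * ((N : ℝ) * (1 / 2 - R)))) / (1 - 2 * ((N : ℝ) ^ 2 / ((N : ℝ) ^ 2 - 1)) ^ 2 * R ^ 2)) * (10 * ((N : ℝ) ^ 2 / (2 * ((N : ℝ) ^ 2 - 4))) + 1 / 2) * R ^ 3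
              + ((10 * ((N : ℝ) ^ 2 / (2 * ((N : ℝ) ^ 2 - 4))) + 1 / 2) / N) * (R ^ 2 / Real.sqrt (1 / 2 - R))) / (1 / 2 - R))) * L * frobNorm (B' - B))
    hfm hfb hwm hwb hφm hφb ?_
  · rw [frobNorm_sub_comm] at key
    exact key
  · intro t ht
    set Bt : Matrix (Fin N) (Fin N) ℂ := B + (t : ℂ) • (B' - B) with hBt
    have hft : (fun u : SUN N => f u + t * w u) =
        fun g : SUN N => (N : ℝ) * ((g : Matrix (Fin N) (Fin N) ℂ) * Bt).trace.re := by
      funext g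
      simp only [hf, hw, hBt, Matrix.mul_add, Matrix.mul_smul, trace_add, trace_smul, Complex.add_re, smul_eq_mul,
        Complex.re_ofReal_mul]
      ring
    have hBt_le : matrixOpNorm Bt ≤ R := by
      have h1 : Bt = ((1 - t : ℝ) : ℂ) • B + ((t : ℝ) : ℂ) • B' := by
        rw [hBt]; push_cast; simp only [smul_sub, sub_smul, one_smul]; abel
      rw [h1]
      calc matrixOpNorm (((1 - t : ℝ) : ℂ) • B + ((t : ℝ) : ℂ) • B')
          ≤ matrixOpNorm (((1 - t : ℝ) : ℂ) • B) + matrixOpNorm (((t : ℝ) : ℂ) • B') := matrixOpNorm_add_le _ _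
        _ = (1 - t) * matrixOpNorm B + t * matrixOpNorm B' := by
            rw [matrixOpNorm_smul, matrixOpNorm_smul, Complex.norm_real, Complex.norm_real, Real.norm_eq_abs,
              Real.norm_eq_abs, abs_of_nonneg (by linarith [ht.2]), abs_of_nonneg ht.1]
        _ ≤ (1 - t) * R + t * R :=
            add_le_add (mul_le_mul_of_nonneg_left hB (by linarith [ht.2])) (mul_le_mul_of_nonneg_left hB' ht.1)
        _ = R := by ring
    have hBt_lt : matrixOpNorm Bt < 1 / 2 := lt_of_le_of_lt hBt_le hR
    have hcov := cov_linear_le_levelTwoR_explicit hN hBt_lt (B' - B) φ hφm hφb hL hφL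
    rw [← hft] at hcov
    refine hcov.trans ?_
    have hmono := levelTwoRBody_mono hN (matrixOpNorm_nonneg Bt) hBt_le hR
    exact mul_le_mul_of_nonneg_right (mul_le_mul_of_nonneg_right hmono hL) (frobNorm_nonneg _)

end Summit.Ventures.YMGap.OneLinkEigen
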